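import Summits.CriticalPhenomena.CardyFormulaZ2.Theorems.CardyBoundaryCoulombGasHalfPlaneMarkDensityLawNoFreeConstant

/-!
# `HalfPlaneMarkDensityLaw` (crux stmt-CriticalPhenomena-5661), line `Sketch`, cycle 7 (`Proportional`):
# stub `stub_shape_prop` (P5) — the `x`-shape of the density forces proportionality to `F∘η`

Pure real analysis on joint subsequential limits.  `G` is a joint subsequential limit, along a strictly
increasing `θ`, of the collinear half-plane crossing probabilities
`P_n(a,b,c,y) = P_{1/2}[[⌊an⌋,⌊bn⌋]×{0} ↔ [⌊cn⌋,⌊yn⌋]×{0} in ℤ×ℕ]`; by c4-0 (`Density.hasDerivAt_jointLimit`)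
`y ↦ G(a,b,c,y)` is differentiable on `(c,∞)`, and by c4-0 (`Density.tendsto_jointLimit_nhdsGT`)
`G(a,b,c,y) → 0` as `y ↓ c`.

SHAPE hypothesis: for `a < b < c` there is `K` with `∂₄G(a,b,c,x)·((x−a)(x−b)(x−c))^{2/3} = K` for all
`x > c`.  Put `Δ := (b−a)(c−b)(c−a)`, `κ := (cardyConst/3)·Δ^{1/3} > 0` and `λ := K/κ`.  Then for `x > c`
`∂₄G(a,b,c,x) = K·((x−a)(x−b)(x−c))^{−2/3} = λ · density a b c x`, and `density a b c x` is the
`x`-derivative of Cardy's `Φ(x) = F(η(a,b,c,x))` (`hasDerivAt_cardy_crossRatio`).  Hence `G(a,b,c,·) − λΦ`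
has zero derivative on the convex set `(c,∞)`, so it is constant there
(`Convex.norm_image_sub_le_of_norm_hasDerivWithin_le` with bound `0`), and it tends to `0` at `c⁺`
(`Φ(x) → F(0) = 0`, `Converse.tendsto_cardy_crossRatio_right`); so it vanishes: `G(a,b,c,y) = λ·F(η(a,b,c,y))`
for every `y > c`.  This is the argument of `NoFreeConstant.jointLimit_eq` with the limit of the crux's
sequence replaced by the shape identity.
-/

noncomputable section

namespace Summit.CriticalPhenomena.CardyFormulaZ2.Cruxes.HalfPlaneMarkDensityLaw.SketchLine

open Literature.Probability.Percolation Literature.Probability.LatticeModels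
open Literature.Probability.RandomPlanarGeometry (crossRatio)
open MeasureTheory Filter Set
open scoped Topology
open Summit.CriticalPhenomena.CardyFormulaZ2.Theorems.HalfPlaneMarkDensityLaw.Negative

namespace Proportional

/-- **The shape identity in terms of the Cardy density.** If
`g′(x)·((x−a)(x−b)(x−c))^{2/3} = K` at some `x > c` (`a < b < c`), then
`g′(x) = (K/κ) · density a b c x` with `κ = (cardyConst/3)·((b−a)(c−b)(c−a))^{1/3}`. [folklore] -/
lemma deriv_eq_div_mul_density {g : ℝ → ℝ} {a b c x K : ℝ} (hab : a < b) (hbc : b < c)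
    (hcx : c < x) (hK : deriv g x * ((x - a) * (x - b) * (x - c)) ^ ((2 : ℝ) / 3) = K) :
    deriv g x = K / (Literature.Probability.RandomPlanarGeometry.cardyConst / 3 *
        ((b - a) * (c - b) * (c - a)) ^ (1 / 3 : ℝ)) * density a b c x := by
  have hPi : 0 < (x - a) * (x - b) * (x - c) := by
    apply mul_pos (mul_pos _ _) <;> linarith
  have hΔ : 0 < (b - a) * (c - b) * (c - a) := by
    apply mul_pos (mul_pos _ _) <;> linarith
  have hP : 0 < ((x - a) * (x - b) * (x - c)) ^ ((2 : ℝ) / 3) := Real.rpow_pos_of_pos hPi _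
  have hP0 : ((x - a) * (x - b) * (x - c)) ^ ((2 : ℝ) / 3) ≠ 0 := hP.ne'
  have hΔ0 : ((b - a) * (c - b) * (c - a)) ^ (1 / 3 : ℝ) ≠ 0 := (Real.rpow_pos_of_pos hΔ _).ne'
  have hc0 : Literature.Probability.RandomPlanarGeometry.cardyConst ≠ 0 :=
    Literature.Probability.RandomPlanarGeometry.cardyConst_pos.ne'
  have hd : deriv g x = K / ((x - a) * (x - b) * (x - c)) ^ ((2 : ℝ) / 3) := by
    rw [eq_div_iff hP0]
    exact hK
  rw [hd, density, Real.rpow_neg hPi.le]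
  field_simp

/-- **Constant from zero derivative, pinned at the left end.** A real function with zero derivative
within `(c,∞)` at every point of `(c,∞)` and tending to `0` at `c⁺` vanishes on `(c,∞)`. [folklore] -/
lemma eq_zero_of_hasDerivWithinAt_zero_Ioi {φ : ℝ → ℝ} {c y : ℝ}
    (hderiv : ∀ x ∈ Ioi c, HasDerivWithinAt φ (0 : ℝ) (Ioi c) x)
    (hlim : Tendsto φ (𝓝[>] c) (𝓝 0)) (hcy : c < y) : φ y = 0 := by
  -- `φ` is constant on `(c, ∞)`
  have hconst : ∀ s ∈ Ioi c, ∀ t ∈ Ioi c, φ s = φ t := by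
    intro s hs t ht
    have h := (convex_Ioi c).norm_image_sub_le_of_norm_hasDerivWithin_le (C := 0) hderiv
      (fun x _ ↦ by simp) hs ht
    rw [zero_mul, norm_le_zero_iff, sub_eq_zero] at h
    exact h.symm
  -- so the constant is the limit `0`
  have hev : φ =ᶠ[𝓝[>] c] fun _ ↦ φ y := by
    filter_upwards [self_mem_nhdsWithin] with t ht
    exact hconst t ht y hcy
  exact tendsto_nhds_unique (tendsto_const_nhds.congr' hev.symm) hlim

/-- STUB P5: the `x`-shape of the density (`∂₄G·((x−a)(x−b)(x−c))^{2/3}` constant in `x`) gives proportionality to `F∘η` (integration from the closing gap `y ↓ c`, where both sides vanish). [folklore] -/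
theorem stub_shape_prop :
    ∀ {θ : ℕ → ℕ} {G : ℝ → ℝ → ℝ → ℝ → ℝ},
      (∀ a b c y : ℝ, a < b → b < c → c < y →
        Tendsto (fun n ↦ μ.real (openCrossing halfPlane (arcA a b (θ n))
          (rowIcc ⌊c * (θ n : ℕ)⌋ ⌊y * (θ n : ℕ)⌋))) atTop (𝓝 (G a b c y))) →
      StrictMono θ → (∀ a b c : ℝ, a < b → b < c → ∃ K : ℝ, ∀ x : ℝ, c < x → deriv (G a b c) x * ((x - a) * (x - b) * (x - c)) ^ ((2 : ℝ) / 3) = K) →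
      (∀ a b c : ℝ, a < b → b < c → ∃ m : ℝ, ∀ y : ℝ, c < y → G a b c y = m * Literature.Probability.RandomPlanarGeometry.cardyFunction (crossRatio ![a, b, c, y])) := by
  intro θ G hG hθ hshape a b c hab hbc
  obtain ⟨K, hK⟩ := hshape a b c hab hbc
  -- the proportionality factor `λ = K/κ`
  set lam : ℝ := K / (Literature.Probability.RandomPlanarGeometry.cardyConst / 3 *
    ((b - a) * (c - b) * (c - a)) ^ (1 / 3 : ℝ)) with hlam
  refine ⟨lam, fun y hcy ↦ ?_⟩
  -- the difference `φ = G(a,b,c,·) − λΦ` has zero derivative on `(c, ∞)`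
  set φ : ℝ → ℝ := fun t ↦ G a b c t -
    lam * Literature.Probability.RandomPlanarGeometry.cardyFunction (crossRatio ![a, b, c, t]) with hφ
  have hderiv : ∀ x ∈ Ioi c, HasDerivWithinAt φ (0 : ℝ) (Ioi c) x := by
    intro x hx
    have h1 := (Density.hasDerivAt_jointLimit hG hθ.tendsto_atTop hab hbc hx).1
    have heq : deriv (G a b c) x = lam * density a b c x :=
      deriv_eq_div_mul_density hab hbc hx (hK x hx)
    have hGd : HasDerivAt (G a b c) (lam * density a b c x) x := heq ▸ h1
    have hΦd : HasDerivAt (fun t : ℝ ↦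
        lam * Literature.Probability.RandomPlanarGeometry.cardyFunction (crossRatio ![a, b, c, t]))
        (lam * density a b c x) x :=
      (hasDerivAt_cardy_crossRatio hab hbc hx).const_mul lam
    have h := hGd.sub hΦd
    rw [sub_self] at h
    exact h.hasDerivWithinAt
  -- and `φ → 0` at `c⁺`
  have hlim : Tendsto φ (𝓝[>] c) (𝓝 0) := by
    have h1 := Density.tendsto_jointLimit_nhdsGT hG hθ hab hbc
    have h2 := (Converse.tendsto_cardy_crossRatio_right a b c hab hbc).const_mul lam
    rw [mul_zero] at h2
    have := h1.sub h2
    rw [sub_zero] at this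
    exact this
  -- so `φ y = 0`
  have hy0 : φ y = 0 := eq_zero_of_hasDerivWithinAt_zero_Ioi hderiv hlim hcy
  have hy0' : G a b c y -
      lam * Literature.Probability.RandomPlanarGeometry.cardyFunction (crossRatio ![a, b, c, y]) = 0 :=
    hy0
  linarith

end Proportional

end Summit.CriticalPhenomena.CardyFormulaZ2.Cruxes.HalfPlaneMarkDensityLaw.SketchLine
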